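import Literature.NumberTheory.Transcendental.KZProductIdeal
import Summits.KontsevichZagierPeriods.KontsevichZagierPeriods.Theorems.ValuedFieldSpecialisationClassLevelExpansionFibreDimOneElementaryB
import Summits.KontsevichZagierPeriods.KontsevichZagierPeriods.Theorems.ValuedFieldSpecialisationClassLevelExpansionFibreDimOnePadding
import Summits.KontsevichZagierPeriods.KontsevichZagierPeriods.Theorems.ValuedFieldSpecialisationClassLevelExpansionFibreDimOneToolkit
import Summits.KontsevichZagierPeriods.KontsevichZagierPeriods.Theorems.ValuedFieldSpecialisationCTConstructionElementarySliceValue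
import Summits.KontsevichZagierPeriods.KontsevichZagierPeriods.Theorems.LiouvilleUnfoldingLogKernelConjectureStubProductFibred

/-!
# Route ValuedFieldSpecialisation — crux `ParametricLifting` (stmt-KontsevichZagierPeriods-3498),
line `registered`/birth, stub S3a `stub_elementaryNet_mem_fibredRelations`: FIBRED PRODUCT
FUNCTORIALITY FOR ELEMENTARY DIVERGENT PRODUCTS

If every monomial group's coefficient class `Σ_{i : pᵢ/qᵢ = p₀/q₀, bᵢ = b₀} mᵢ [ρᵢ]` is a KZ
relation, then the elementary net `Σ mᵢ [Pᵢ]` is a FIBRED relation: `Pᵢ ≡ M_{p,q,b} × ρᵢ` with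
the parameter a coordinate of the fixed factor, and `[t] * relations ⊆ fibredRelations`
(`…LiouvilleUnfolding.SpectatorLocalisation.stub_productFibred`).
Helper (`--supports`) for item stmt-KontsevichZagierPeriods-3498. [Kontsevich–Zagier 2001, §1.2]

The argument. Group the indices `i` by monomial type `(pᵢ/qᵢ, bᵢ)`
(`Finset.sum_fiberwise_of_maps_to`); it suffices that each group sum `Σ_group mᵢ [Pᵢ]` is a
fibred relation. Fix a group, with representative `i₀` (`p₀ = p i₀ < q₀ = q i₀`, `b₀ = b i₀`),
and let `M` be the elementary divergent product over the UNIT representation `[pt, 1]` of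
dimension `0` (`exists_elementaryRep`): domain
`{(s, u, y) | 0 < s < 1, 0 < u, u^{q₀} s^{p₀} < 1, s ≤ y_j ≤ 1}`, integrand `∏ y_j⁻¹`. For `i` in
the group, `Pᵢ` has the same domain and, on it, the same integrand as the coordinate
relabelling of the Fubini product `M × ρᵢ` along `Fin ((b₀ + 2) + dᵢ) ≃ Fin (bᵢ + dᵢ + 2)` (same
underlying naturals, `bᵢ = b₀`; the conditions `u^{qᵢ} s^{pᵢ} < 1` and `u^{q₀} s^{p₀} < 1` agree
for `s, u > 0` because both read `u < s^{-pᵢ/qᵢ} = s^{-p₀/q₀}`,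
`pow_mul_pow_lt_one_iff_lt_rpow`), so `[Pᵢ] − [M × ρᵢ] ∈ fibredRelations` (congruence
`of_sub_of_mem_fibredRelations_of_eqOn` and the fibred relabelling move
`of_sub_of_reindex_mem_fibredRelations`, which fixes the parameter coordinate `0`). Hence
`Σ_group mᵢ [Pᵢ] ≡ [M] * Σ_group mᵢ [ρᵢ]` modulo `fibredRelations` (`KZ.of_mul_of`), and the
right-hand side is a fibred relation by `stub_productFibred` (`[t] * relations ⊆ fibredRelations`
for `dim t ≥ 1`) applied to the hypothesis on the group of `i₀`.

Sources: M. Kontsevich, D. Zagier, *Periods* (2001), §1.2 (rules (1)–(3)), §4.1 (Fubini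
product); the fibred calculus and the elementary products are this route's. Deliberately NOT
here: anything about the coefficient classes being relations (stub S3b, the open core).
-/

noncomputable section

namespace Summit.KontsevichZagierPeriods.ValuedFieldSpecialisation

open MeasureTheory Set Filter
open scoped Topology
open Literature.NumberTheory.Transcendental Literature.NumberTheory.Transcendental.KZ

/-! ### Relabelling coordinates in any positive dimension -/

/-- **Relabelling the fibre coordinates is a fibred move, any positive dimension.** For
`r : IntegralRep D` with `0 < D` and a relabelling `e : Fin D ≃ Fin D'` sending the parameter index
`0` to `0`, `[r] − [r.reindex e] ∈ fibredRelations` (write `D = n + 1`, `D' = k + 1` and use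
`of_sub_of_reindex_mem_fibredRelations`). [Kontsevich–Zagier 2001, §1.2, rule (2)] [folklore] -/
theorem of_sub_of_reindex_mem_fibredRelations_of_pos {D D' : ℕ} (hD : 0 < D) (r : IntegralRep D)
    (e : Fin D ≃ Fin D') (he : ((e ⟨0, hD⟩ : Fin D') : ℕ) = 0) :
    of r - of (r.reindex e) ∈ fibredRelations := by
  obtain ⟨n, rfl⟩ : ∃ n, D = n + 1 := ⟨D - 1, by omega⟩
  have hD' : n + 1 = D' := by simpa using Fintype.card_congr e
  subst hD'
  exact of_sub_of_reindex_mem_fibredRelations r e (Fin.ext he)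

/-! ### One elementary product against the Fubini product `M × ρ` -/

/-- **An elementary divergent product is fibred-equivalent to `M × ρ`.** Let `P` be the
elementary divergent product with data `(p, q, b, ρ)` (dimension `b + d + 2`, coordinates
`(s, u, y, w)`, domain `0 < s < 1`, `0 < u`, `u^q s^p < 1`, `s ≤ y_j ≤ 1`, `w ∈ ρ.domain`,
integrand `∏ y_j⁻¹ · ρ.integrand w`) and `M` the elementary divergent product with data
`(p₀, q₀, b₀, [pt, 1])` over the unit representation of dimension `0` (coordinates `(s, u, y)`,
integrand `∏ y_j⁻¹ · 1`). If `b = b₀` and `p/q = p₀/q₀` (`0 < q`, `0 < q₀`), then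
`[P] − [M × ρ] ∈ fibredRelations`: along the relabelling `Fin ((b₀ + 2) + d) ≃ Fin (b + d + 2)`
of the same underlying naturals (which fixes `0`), `M × ρ` becomes a representation with the
domain of `P` (`u^q s^p < 1 ↔ u < s^{-p/q} = s^{-p₀/q₀} ↔ u^{q₀} s^{p₀} < 1` for `s, u > 0`)
and, on it, the integrand of `P` (`IntegralRep.prod_integrand_eq`); relabelling is a fibred
move (`of_sub_of_reindex_mem_fibredRelations_of_pos`) and equal data are fibred-equivalent
(`of_sub_of_mem_fibredRelations_of_eqOn`). [Kontsevich–Zagier 2001, §1.2, §4.1] [folklore] -/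
theorem of_elementary_sub_of_prod_mem_fibredRelations {p q p₀ q₀ b b₀ d : ℕ} (hq : 0 < q)
    (hq₀ : 0 < q₀) (hpq : (p : ℝ) / q = (p₀ : ℝ) / q₀) (hb : b = b₀) (ρ : IntegralRep d)
    (P : IntegralRep (b + d + 1 + 1)) (M : IntegralRep (b₀ + 0 + 1 + 1))
    (hPd : P.domain = {z | ∃ (s u : ℝ) (y : Fin b → ℝ) (w : Fin d → ℝ),
      z = Matrix.vecCons s (Matrix.vecCons u (Fin.append y w)) ∧ 0 < s ∧ s < 1 ∧ 0 < u ∧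
        u ^ q * s ^ p < 1 ∧ (∀ j, s ≤ y j ∧ y j ≤ 1) ∧ w ∈ ρ.domain})
    (hPi : P.integrand = fun z => (∏ j : Fin b, (z (Fin.castAdd d j).succ.succ)⁻¹) *
      ρ.integrand (fun l : Fin d => z (Fin.natAdd b l).succ.succ))
    (hMd : M.domain = {z | ∃ (s u : ℝ) (y : Fin b₀ → ℝ) (w : Fin 0 → ℝ),
      z = Matrix.vecCons s (Matrix.vecCons u (Fin.append y w)) ∧ 0 < s ∧ s < 1 ∧ 0 < u ∧
        u ^ q₀ * s ^ p₀ < 1 ∧ (∀ j, s ≤ y j ∧ y j ≤ 1) ∧ w ∈ IntegralRep.unit.domain})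
    (hMi : M.integrand = fun z => (∏ j : Fin b₀, (z (Fin.castAdd 0 j).succ.succ)⁻¹) *
      IntegralRep.unit.integrand (fun l : Fin 0 => z (Fin.natAdd b₀ l).succ.succ)) :
    of P - of (M.prod ρ) ∈ fibredRelations := by
  subst hb
  rw [elementaryDomain_eq p q b ρ] at hPd
  rw [elementaryDomain_eq p₀ q₀ b IntegralRep.unit] at hMd
  -- the divergence conditions of `P` and of `M` agree
  have hexp : (-(p : ℝ) / q) = (-(p₀ : ℝ) / q₀) := by rw [neg_div, neg_div, hpq]
  have hiff : ∀ {s u : ℝ}, 0 < s → 0 < u → (u ^ q₀ * s ^ p₀ < 1 ↔ u ^ q * s ^ p < 1) := by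
    intro s u hs hu
    rw [pow_mul_pow_lt_one_iff_lt_rpow hs hu.le hq, pow_mul_pow_lt_one_iff_lt_rpow hs hu.le hq₀,
      hexp]
  -- the relabelling `Fin ((b + 2) + d) ≃ Fin (b + d + 2)` (same underlying naturals)
  obtain ⟨e, he⟩ :
      ∃ e : Fin (b + 0 + 1 + 1 + d) ≃ Fin (b + d + 1 + 1), ∀ i, ((e i : Fin _) : ℕ) = i :=
    ⟨finCongr (by omega), fun i => rfl⟩
  have he0 : e (Fin.castAdd d (0 : Fin (b + 0 + 1 + 1))) = 0 := Fin.ext (by rw [he]; simp)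
  have he1 : e (Fin.castAdd d (1 : Fin (b + 0 + 1 + 1))) = 1 := Fin.ext (by rw [he]; simp)
  have hey : ∀ j : Fin b,
      e (Fin.castAdd d ((Fin.castAdd 0 j).succ.succ)) = (Fin.castAdd d j).succ.succ :=
    fun j => Fin.ext (by rw [he]; simp)
  have hew : ∀ l : Fin d, e (Fin.natAdd (b + 0 + 1 + 1) l) = (Fin.natAdd b l).succ.succ :=
    fun l => Fin.ext (by rw [he]; simp; omega)
  -- Step 1: relabelling `M × ρ` is a fibred move
  have h₁ : of (M.prod ρ) - of ((M.prod ρ).reindex e) ∈ fibredRelations :=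
    of_sub_of_reindex_mem_fibredRelations_of_pos (by omega) (M.prod ρ) e (he _)
  -- Step 2: the relabelled product has the data of `P`
  have h₂ : of P - of ((M.prod ρ).reindex e) ∈ fibredRelations := by
    refine of_sub_of_mem_fibredRelations_of_eqOn ?_ ?_
    · rw [IntegralRep.reindex_domain, IntegralRep.prod_domain, hPd]
      ext w
      simp only [mem_setOf_eq, IntegralRep.mem_prodDomain, hMd, he0, he1, hey, hew,
        IntegralRep.unit_domain, mem_univ, and_true]
      constructor
      · rintro ⟨⟨hs, hs1, hu, huq, hy⟩, hw⟩
        exact ⟨hs, hs1, hu, (hiff hs hu).mp huq, hy, hw⟩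
      · rintro ⟨hs, hs1, hu, huq, hy, hw⟩
        exact ⟨⟨hs, hs1, hu, (hiff hs hu).mpr huq, hy⟩, hw⟩
    · intro z _
      rw [IntegralRep.reindex_integrand, IntegralRep.prod_integrand_eq, hPi]
      simp only [IntegralRep.prodFun_apply, hMi, IntegralRep.unit_integrand, mul_one, hey, hew]
  have : of P - of (M.prod ρ) =
      (of P - of ((M.prod ρ).reindex e)) - (of (M.prod ρ) - of ((M.prod ρ).reindex e)) := by
    abel
  rw [this]
  exact fibredRelations.sub_mem h₂ h₁

/-! ### The stub -/

/-- **Stub S3a — the elementary net of a resonance-free expansion is a fibred relation as soon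
as its coefficient classes are relations.** Let `Pᵢ` (`i : Fin k`) be elementary divergent
products with data `(pᵢ < qᵢ, bᵢ, ρᵢ)` (dimension `bᵢ + dᵢ + 2`; domain `0 < s < 1`, `0 < u`,
`u^{qᵢ} s^{pᵢ} < 1`, `s ≤ y_j ≤ 1`, `w ∈ ρᵢ.domain`; integrand `∏ y_j⁻¹ · ρᵢ.integrand w`) and
`mᵢ ∈ ℤ`. If for every index `i₀` the coefficient class of its monomial group,
`Σ_{i : pᵢ/qᵢ = p_{i₀}/q_{i₀}, bᵢ = b_{i₀}} mᵢ [ρᵢ]`, is a KZ relation, then `Σᵢ mᵢ [Pᵢ]` is a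
FIBRED relation. Proof: split the sum by monomial type; within the group of `i₀`, each `Pᵢ` is
fibred-equivalent to the Fubini product `M × ρᵢ` with the FIXED elementary factor
`M = M(p_{i₀}, q_{i₀}, b_{i₀})` over the unit representation
(`of_elementary_sub_of_prod_mem_fibredRelations`), so the group sum is
`[M] * Σ_group mᵢ [ρᵢ]` modulo `fibredRelations` (`KZ.of_mul_of`), and
`[M] * relations ⊆ fibredRelations` because `dim M ≥ 1`
(`…SpectatorLocalisation.stub_productFibred`). [Kontsevich–Zagier 2001, §1.2, §4.1] [folklore] -/
theorem stub_elementaryNet_mem_fibredRelations :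
    ∀ (k : ℕ) (m : Fin k → ℤ) (p q b d : Fin k → ℕ) (ρ : (i : Fin k) → KZ.IntegralRep (d i)) (P : (i : Fin k) → KZ.IntegralRep (b i + d i + 1 + 1)), (∀ i, 0 < q i ∧ p i < q i ∧ (0 < p i ∨ 0 < b i) ∧ (P i).domain = {z | ∃ (s u : ℝ) (y : Fin (b i) → ℝ) (w : Fin (d i) → ℝ), z = Matrix.vecCons s (Matrix.vecCons u (Fin.append y w)) ∧ 0 < s ∧ s < 1 ∧ 0 < u ∧ u ^ (q i) * s ^ (p i) < 1 ∧ (∀ j, s ≤ y j ∧ y j ≤ 1) ∧ w ∈ (ρ i).domain} ∧ (P i).integrand = fun z => (∏ j : Fin (b i), (z (Fin.castAdd (d i) j).succ.succ)⁻¹) * (ρ i).integrand (fun l : Fin (d i) => z (Fin.natAdd (b i) l).succ.succ)) → (∀ i₀ : Fin k, (∑ i ∈ Finset.univ.filter (fun i => (p i / q i : ℝ) = (p i₀ / q i₀ : ℝ) ∧ b i = b i₀), m i • KZ.of (ρ i)) ∈ KZ.relations) → (∑ i, m i • KZ.of (P i)) ∈ KZ.fibredRelations := by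
  intro k m p q b d ρ P hP hgroup
  -- Step 1: every monomial group is a fibred relation
  have hG : ∀ i₀ : Fin k, (∑ i ∈ Finset.univ.filter
      (fun i => (p i / q i : ℝ) = (p i₀ / q i₀ : ℝ) ∧ b i = b i₀), m i • KZ.of (P i)) ∈
        KZ.fibredRelations := by
    intro i₀
    obtain ⟨hq₀, hpq₀, -, -, -⟩ := hP i₀
    -- the fixed factor of the group: the elementary product over the unit representation
    obtain ⟨M, hMd, hMi⟩ := exists_elementaryRep (b := b i₀) hpq₀ IntegralRep.unit
    set G := Finset.univ.filter (fun i => (p i / q i : ℝ) = (p i₀ / q i₀ : ℝ) ∧ b i = b i₀)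
    have h1 : of M * (∑ i ∈ G, m i • of (ρ i)) ∈ fibredRelations :=
      LiouvilleUnfolding.SpectatorLocalisation.stub_productFibred _ M (by omega) _ (hgroup i₀)
    have h2 : of M * (∑ i ∈ G, m i • of (ρ i)) = ∑ i ∈ G, m i • of (M.prod (ρ i)) := by
      rw [← FormalRep.mul_apply, map_sum]
      refine Finset.sum_congr rfl fun i _ => ?_
      rw [map_zsmul, FormalRep.mul_apply, of_mul_of]
    have h3 : ∀ i ∈ G, of (P i) - of (M.prod (ρ i)) ∈ fibredRelations := by
      intro i hi
      obtain ⟨hpqi, hbi⟩ := (Finset.mem_filter.mp hi).2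
      obtain ⟨hq, -, -, hPd, hPi⟩ := hP i
      exact of_elementary_sub_of_prod_mem_fibredRelations hq hq₀ hpqi hbi (ρ i) (P i) M hPd
        hPi hMd hMi
    have h4 : ∑ i ∈ G, m i • of (P i) =
        ∑ i ∈ G, m i • (of (P i) - of (M.prod (ρ i))) + of M * ∑ i ∈ G, m i • of (ρ i) := by
      rw [h2, ← Finset.sum_add_distrib]
      refine Finset.sum_congr rfl fun i _ => ?_
      rw [smul_sub, sub_add_cancel]
    rw [h4]
    exact fibredRelations.add_mem (sum_mem fun i hi => zsmul_mem (h3 i hi) _) h1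
  -- Step 2: split the net by monomial type `(pᵢ/qᵢ, bᵢ)`
  let τ : Fin k → ℝ × ℕ := fun i => ((p i : ℝ) / q i, b i)
  rw [← Finset.sum_fiberwise_of_maps_to (s := Finset.univ) (t := Finset.univ.image τ)
    (g := τ) (fun i hi => Finset.mem_image_of_mem τ hi) (fun i => m i • KZ.of (P i))]
  refine sum_mem fun v hv => ?_
  obtain ⟨i₀, -, rfl⟩ := Finset.mem_image.mp hv
  have hsum : ∑ i ∈ Finset.univ.filter (fun i => τ i = τ i₀), m i • KZ.of (P i) =
      ∑ i ∈ Finset.univ.filter (fun i => (p i / q i : ℝ) = (p i₀ / q i₀ : ℝ) ∧ b i = b i₀),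
        m i • KZ.of (P i) :=
    Finset.sum_congr (Finset.filter_congr fun i _ => by simp [τ, Prod.ext_iff])
      fun _ _ => rfl
  rw [hsum]
  exact hG i₀

end Summit.KontsevichZagierPeriods.ValuedFieldSpecialisation
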